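/-
Copyright (c) 2026 the pub-hodgecm-mathlib formalisation cell (harness21).  Prover seat hodgecm-mathlib-K2E3-p32 (g0), HCML Track B «K2-LIT» (close-out strike line L4
`stub_StCharTS`), h413 = `stmt-HodgeConjecture-24833`, line `K2_E3_EllipticInputs`, unit U4 «Keys», PART «U4Keys» socket :155 (U4f-χ₁-ram-one-d0B)
`sig_K2E3KeysThmTwoContractingRamifiedCharOneDepthZeroNormTrivial` (cell «U4-RAM»; Z3-c SHARED FRAME v1 (K2E3-p03 (g9)), head «measurableSet_S_* ∕ Sh : the regions are Borel» of
(II)-a): THE SHELL REGIONS OF `N(L⁺_v)` ARE BOREL.  2026-09-04.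
-/
import Summits.HodgeConjecture.HodgeConjecture.Theorems.K2E3BranchBHaarFactsN   -- ★ (R90-C10-p04) the frame's measure-theoretic currency on `N(L⁺_v)`; brings ★ `HeisenbergStrataMeasure` (`isOpen_setOf_valued_apply_lt_one`, `isClosed_setOf_valued_apply_le_one`), `cmBorelTriple`
import HarnessLib

/-!
# K2 ∕ E3 «EllipticInputs», unit U4 «Keys» — (U4f-χ₁-ram-one-d0B), frame-v1 head of (II)-a: THE SHELL REGIONS `S_gt = {|z|_w > 1}`, `S_ge = {|z|_w ≥ 1}`, `Sh 0 = {|z|_w = 1}`,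
# `N₀ = {|z|_w ≤ 1}` OF `N(L⁺_v)` (`z = n₀₂`) ARE OPEN ∕ CLOSED, HENCE BOREL
# [Rogawski1990 §1.10; Keys1984 §7]

Cell `pub/hodgecm-mathlib`, crux H413 = `stmt-HodgeConjecture-24833`, route of record `HCCMUnconditional`; cell «U4-RAM» (Z3-c frame v1 `K2/K2E3-p03/g9/Z3c-frame.v1.txt`).  THEOREMS ONLY
(no `def`, no `instance`, no `notation`, no named-fact hypothesis, no `sorry`); lane `--supports stmt-HodgeConjecture-24833 --as helper`, count-neutral.  NOT THE PAYER.

THE POINT.  The entry `n ↦ z(n) = n₀₂ ∈ R = L ⊗ L⁺_v` is continuous on `N(L⁺_v) ≤ U(Φ₃)(L⁺_v) ≤ GL₃(R)`, and `{|x_w| < 1}` is open, `{|x_w| ≤ 1}` closed in `R` (★ `HeisenbergStrataMeasure` §1); so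
the four regions of the Z3-c frame are preimages of open∕closed sets — the letters `hSgt`, `hSge`, `hSh0` (`MeasurableSet …`) of ★ `K2E3BranchBCasselmanPairEntries` ∕ `…ClosedForms` and
of the closing theorem 📤 `K2E3KeysThmTwoDepthZeroBranchBInert`, DISCHARGED for every Borel structure on `N(L⁺_v)`.
* `continuous_entry_zero_two`; `isOpen_setOf_one_lt_v`, `isClosed_setOf_one_le_v`, `isClosed_setOf_v_le_one`, `isClosed_setOf_v_eq_one`; `measurableSet_setOf_one_lt_v`,
  `measurableSet_setOf_one_le_v`, `measurableSet_setOf_v_le_one`, `measurableSet_setOf_v_eq_one`.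
HONEST LABEL.  HC_CM is proved only modulo the 7 printed citations (2 remaining named inputs: hLiu418 = `stmt-HodgeConjecture-24832`, h413 = `stmt-HodgeConjecture-24833`) until rung 0
closes; count-neutral — this file does NOT pay the leaf; no printed citation is discharged.

## References
* [Rogawski1990] J. Rogawski, Ann. of Math. Stud. 123 (1990), §1.10 p. 9 (`N`, the entry `z`).
* [Keys1984] D. Keys, Compositio Math. 51 (1984), §7 Theorem (2) p. 126.
-/

set_option autoImplicit false
-- the mandated namespace has the single-problem summit's repeated segment (`HodgeConjecture.HodgeConjecture`)
set_option linter.dupNamespace false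

noncomputable section

open NumberField IsDedekindDomain MeasureTheory
open scoped Matrix MatrixGroups WithZero Valued
open Literature.NumberTheory Literature.NumberTheory.Automorphic Literature.NumberTheory.Automorphic.UnitaryGroup

namespace Summit.HodgeConjecture.HodgeConjecture.Cruxes.H413.K2E3BranchBShellRegions

variable (L : Type) [Field L] [NumberField L] [IsCMField L] (v : HeightOneSpectrum (𝓞 ↥(maximalRealSubfield L)))
  (w : PlacesOver L v)

/-! ## §1 The entry `z = n₀₂` is continuous on `N(L⁺_v)` -/

/-- `n ↦ z(n) = n₀₂` is continuous on `N(L⁺_v)` (two subtype inclusions, `Units.val`, a matrix entry). [cite: Rogawski1990, §1.10 p. 9] -/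
theorem continuous_entry_zero_two :
    Continuous (fun n : ↥(cmBorelTriple L 3 v).N => ((n : ↥(unitaryGroupOfForm (conjLocal L (IsCMField.complexConj L) v) (cmLocalForm L 3 v))) : GL (Fin 3) (LocalRing L v)).val 0 2) := by
  have h1 : Continuous (fun n : ↥(cmBorelTriple L 3 v).N => (n : ↥(unitaryGroupOfForm (conjLocal L (IsCMField.complexConj L) v) (cmLocalForm L 3 v)))) := continuous_subtype_val
  have h2 : Continuous (fun u : ↥(unitaryGroupOfForm (conjLocal L (IsCMField.complexConj L) v) (cmLocalForm L 3 v)) => (u : GL (Fin 3) (LocalRing L v))) := continuous_subtype_val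
  have h3 : Continuous (fun g : GL (Fin 3) (LocalRing L v) => g.val) := Units.continuous_val
  exact (h3.comp (h2.comp h1)).matrix_elem 0 2

/-! ## §2 The regions are open ∕ closed -/

/-- **`S_gt = {|z|_w > 1}` is OPEN** in `N(L⁺_v)` (complement of the preimage of the closed `{|x_w| ≤ 1}`). [cite: Rogawski1990, §1.10 p. 9] [cite: Keys1984, §7] -/
theorem isOpen_setOf_one_lt_v : IsOpen {m : ↥(cmBorelTriple L 3 v).N | 1 < Valued.v (((((m : ↥(unitaryGroupOfForm (conjLocal L (IsCMField.complexConj L) v) (cmLocalForm L 3 v))) : GL (Fin 3) (LocalRing L v)) : Matrix (Fin 3) (Fin 3) (LocalRing L v)) 0 2) w)} := by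
  have h : {m : ↥(cmBorelTriple L 3 v).N | 1 < Valued.v (((((m : ↥(unitaryGroupOfForm (conjLocal L (IsCMField.complexConj L) v) (cmLocalForm L 3 v))) : GL (Fin 3) (LocalRing L v)) : Matrix (Fin 3) (Fin 3) (LocalRing L v)) 0 2) w)} =
      (fun n : ↥(cmBorelTriple L 3 v).N => ((n : ↥(unitaryGroupOfForm (conjLocal L (IsCMField.complexConj L) v) (cmLocalForm L 3 v))) : GL (Fin 3) (LocalRing L v)).val 0 2) ⁻¹' {x : LocalRing L v | Valued.v (x w) ≤ 1}ᶜ :=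
    Set.ext fun _ => by simp only [Set.mem_setOf_eq, Set.mem_preimage, Set.mem_compl_iff, not_le]
  rw [h]
  exact (isClosed_setOf_valued_apply_le_one L v w).isOpen_compl.preimage (continuous_entry_zero_two L v)

/-- **`S_ge = {|z|_w ≥ 1}` is CLOSED** in `N(L⁺_v)` (complement of the preimage of the open `{|x_w| < 1}`). [cite: Rogawski1990, §1.10 p. 9] [cite: Keys1984, §7] -/
theorem isClosed_setOf_one_le_v : IsClosed {m : ↥(cmBorelTriple L 3 v).N | 1 ≤ Valued.v (((((m : ↥(unitaryGroupOfForm (conjLocal L (IsCMField.complexConj L) v) (cmLocalForm L 3 v))) : GL (Fin 3) (LocalRing L v)) : Matrix (Fin 3) (Fin 3) (LocalRing L v)) 0 2) w)} := by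
  have h : {m : ↥(cmBorelTriple L 3 v).N | 1 ≤ Valued.v (((((m : ↥(unitaryGroupOfForm (conjLocal L (IsCMField.complexConj L) v) (cmLocalForm L 3 v))) : GL (Fin 3) (LocalRing L v)) : Matrix (Fin 3) (Fin 3) (LocalRing L v)) 0 2) w)} =
      (fun n : ↥(cmBorelTriple L 3 v).N => ((n : ↥(unitaryGroupOfForm (conjLocal L (IsCMField.complexConj L) v) (cmLocalForm L 3 v))) : GL (Fin 3) (LocalRing L v)).val 0 2) ⁻¹' {x : LocalRing L v | Valued.v (x w) < 1}ᶜ :=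
    Set.ext fun _ => by simp only [Set.mem_setOf_eq, Set.mem_preimage, Set.mem_compl_iff, not_lt]
  rw [h]
  exact (isOpen_setOf_valued_apply_lt_one L v w).isClosed_compl.preimage (continuous_entry_zero_two L v)

/-- **`N₀ = {|z|_w ≤ 1}` is CLOSED** in `N(L⁺_v)`. [cite: Rogawski1990, §1.10 p. 9] [cite: Keys1984, §7] -/
theorem isClosed_setOf_v_le_one : IsClosed {m : ↥(cmBorelTriple L 3 v).N | Valued.v (((((m : ↥(unitaryGroupOfForm (conjLocal L (IsCMField.complexConj L) v) (cmLocalForm L 3 v))) : GL (Fin 3) (LocalRing L v)) : Matrix (Fin 3) (Fin 3) (LocalRing L v)) 0 2) w) ≤ 1} :=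
  (isClosed_setOf_valued_apply_le_one L v w).preimage (continuous_entry_zero_two L v)

/-- **`Sh 0 = {|z|_w = 1}` is CLOSED** in `N(L⁺_v)` (`= N₀ ∩ S_ge`). [cite: Rogawski1990, §1.10 p. 9] [cite: Keys1984, §7] -/
theorem isClosed_setOf_v_eq_one : IsClosed {m : ↥(cmBorelTriple L 3 v).N | Valued.v (((((m : ↥(unitaryGroupOfForm (conjLocal L (IsCMField.complexConj L) v) (cmLocalForm L 3 v))) : GL (Fin 3) (LocalRing L v)) : Matrix (Fin 3) (Fin 3) (LocalRing L v)) 0 2) w) = 1} := by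
  have h : {m : ↥(cmBorelTriple L 3 v).N | Valued.v (((((m : ↥(unitaryGroupOfForm (conjLocal L (IsCMField.complexConj L) v) (cmLocalForm L 3 v))) : GL (Fin 3) (LocalRing L v)) : Matrix (Fin 3) (Fin 3) (LocalRing L v)) 0 2) w) = 1} = {m : ↥(cmBorelTriple L 3 v).N | Valued.v (((((m : ↥(unitaryGroupOfForm (conjLocal L (IsCMField.complexConj L) v) (cmLocalForm L 3 v))) : GL (Fin 3) (LocalRing L v)) : Matrix (Fin 3) (Fin 3) (LocalRing L v)) 0 2) w) ≤ 1} ∩ {m : ↥(cmBorelTriple L 3 v).N | 1 ≤ Valued.v (((((m : ↥(unitaryGroupOfForm (conjLocal L (IsCMField.complexConj L) v) (cmLocalForm L 3 v))) : GL (Fin 3) (LocalRing L v)) : Matrix (Fin 3) (Fin 3) (LocalRing L v)) 0 2) w)} :=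
    Set.ext fun _ => by simp only [Set.mem_setOf_eq, Set.mem_inter_iff]; exact le_antisymm_iff
  rw [h]
  exact (isClosed_setOf_v_le_one L v w).inter (isClosed_setOf_one_le_v L v w)

/-! ## §3 Hence Borel -/

/-- `S_gt` is Borel — the letter `hSgt`. [cite: Keys1984, §7] -/
theorem measurableSet_setOf_one_lt_v [MeasurableSpace ↥(cmBorelTriple L 3 v).N] [BorelSpace ↥(cmBorelTriple L 3 v).N] : MeasurableSet {m : ↥(cmBorelTriple L 3 v).N | 1 < Valued.v (((((m : ↥(unitaryGroupOfForm (conjLocal L (IsCMField.complexConj L) v) (cmLocalForm L 3 v))) : GL (Fin 3) (LocalRing L v)) : Matrix (Fin 3) (Fin 3) (LocalRing L v)) 0 2) w)} :=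
  (isOpen_setOf_one_lt_v L v w).measurableSet

/-- `S_ge` is Borel — the letter `hSge`. [cite: Keys1984, §7] -/
theorem measurableSet_setOf_one_le_v [MeasurableSpace ↥(cmBorelTriple L 3 v).N] [BorelSpace ↥(cmBorelTriple L 3 v).N] : MeasurableSet {m : ↥(cmBorelTriple L 3 v).N | 1 ≤ Valued.v (((((m : ↥(unitaryGroupOfForm (conjLocal L (IsCMField.complexConj L) v) (cmLocalForm L 3 v))) : GL (Fin 3) (LocalRing L v)) : Matrix (Fin 3) (Fin 3) (LocalRing L v)) 0 2) w)} :=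
  (isClosed_setOf_one_le_v L v w).measurableSet

/-- `N₀ = {|z|_w ≤ 1}` is Borel. [cite: Keys1984, §7] -/
theorem measurableSet_setOf_v_le_one [MeasurableSpace ↥(cmBorelTriple L 3 v).N] [BorelSpace ↥(cmBorelTriple L 3 v).N] : MeasurableSet {m : ↥(cmBorelTriple L 3 v).N | Valued.v (((((m : ↥(unitaryGroupOfForm (conjLocal L (IsCMField.complexConj L) v) (cmLocalForm L 3 v))) : GL (Fin 3) (LocalRing L v)) : Matrix (Fin 3) (Fin 3) (LocalRing L v)) 0 2) w) ≤ 1} :=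
  (isClosed_setOf_v_le_one L v w).measurableSet

/-- `Sh 0` is Borel — the letter `hSh0`. [cite: Keys1984, §7] -/
theorem measurableSet_setOf_v_eq_one [MeasurableSpace ↥(cmBorelTriple L 3 v).N] [BorelSpace ↥(cmBorelTriple L 3 v).N] : MeasurableSet {m : ↥(cmBorelTriple L 3 v).N | Valued.v (((((m : ↥(unitaryGroupOfForm (conjLocal L (IsCMField.complexConj L) v) (cmLocalForm L 3 v))) : GL (Fin 3) (LocalRing L v)) : Matrix (Fin 3) (Fin 3) (LocalRing L v)) 0 2) w) = 1} :=
  (isClosed_setOf_v_eq_one L v w).measurableSet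

end Summit.HodgeConjecture.HodgeConjecture.Cruxes.H413.K2E3BranchBShellRegions

end
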